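import Summits.AtomisticToContinuum.HydrodynamicLimit.Theses.ResponseRigidity
import Summits.AtomisticToContinuum.HydrodynamicLimit.Theorems.RelayRaceLocalityRestartPrincipleStubEulerProfileFamily
import Summits.AtomisticToContinuum.HydrodynamicLimit.Theorems.RelayRaceLocalityRestartPrincipleStubMeansByCharacteristics
import HarnessLib

/-!
# Birth skeleton — crux `EngineReduction` (stmt-AtomisticToContinuum-15327)

Route `route-AtomisticToContinuum-ResponseRigidity` (sub-problem `HydrodynamicLimit`), crux by rule, rank 5:

  `EngineReduction := SlavedContactSynergy → CLTScaleConcentration → RenewalDefect → MeanHydroLimitInBand`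

("only cruxes may feed `closes`"; the route header: "EngineReduction itself is the composition
MeansByCharacteristics ∘ SufficiencyToFlowBox ∘ RigidityTransfer with MeanMapRegularity and EulerProfileFamily
(all typed supports), which is how provers are meant to discharge it").  Since
`Theorems.RestartPrinciple.hydrodynamicLimit_iff_meanHydroLimitInBand` (landed) the target `MeanHydroLimitInBand`
(stmt-11927) is the packing-guarded conjunct in the mean, so this crux says: the three dynamical cruxes C1–C3 decide
Euler.  The skeleton below is the route's own two-layer cut of that implication, with the two supports that have
ALREADY LANDED consumed as theorems and the three open ones as the registered stubs.

THE LINE (response-rigidity engine → flow box → characteristics):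

* `stub_rigidityTransfer : ResponseRigidity.RigidityTransfer` (= support item stmt-AtomisticToContinuum-15332 BY NAME;
  `SlavedContactSynergy → CLTScaleConcentration → RenewalDefect → HydrodynamicSufficiency`) — THE ENGINE, load-bearing,
  difficulty L: Lipschitz-in-lag from C2 (Bessel/Efron–Stein gives `‖μ₁‖₂ = O(1)`); the exact one-collision
  Campbell/Palm renewal identity across one step of `d` mean free times (C3 = the time shift off equilibrium); tower
  property; Hoeffding split at OUTGOING contact (C1 = the synergy is slaved to the ⊥-part of `μ₁`); symmetrisation
  `E_flux[(ψ(v)−ψ(v'))(μ(v')+μ(w'))] = ⟨ψ, Lμ⟩` for the LINEARISED hard-sphere Boltzmann operator; self-adjointness,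
  `ker L = span{1, v, |v|²}`, spectral gap (Baranger–Mouhot 2005), absorption of the slaved term for `ϵ` below the gap
  ⇒ the one-sphere response is within `κ` in `L²(LG_τ)` of an affine function of the collision invariants
  (`HydrodynamicSufficiency`, stmt-15328).  Checked on paper at constant profiles by the route planner.
* `stub_sufficiencyToFlowBox : ResponseRigidity.SufficiencyToFlowBox` (= support item stmt-15333 BY NAME;
  `HydrodynamicSufficiency → SlavedContactSynergy → CLTScaleConcentration → RenewalDefect → FlowBoxDecoupling`) —
  difficulty L: the exact score identities (`∂_τ M = Cov(profile score, Y)`, exponential family; `∂_s M =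
  Cov(dynamical score, Y)`, Kawasaki/TTCF with the collisional score as a contact-flux integral) and Yau's
  cancellation (hydro projection of the dynamical score = Euler profile score up to o(1) statics, incl. the virial
  pressure) make the flow-box defect `Cov(⊥-score(0), Y_s)`; kinetic part `⟨Burnett, μ₁⟩ → 0` by sufficiency,
  collisional part a flux pairing with `μ₂`, reduced by the same Hoeffding split and slaving ⇒ `FlowBoxDecoupling`
  (stmt-15329, `|M^N(s+h,τ) − M^N(s,τ+h)| ≤ κh`).
* `stub_meanMapRegularity : ResponseRigidity.MeanMapRegularity` (= support item stmt-15330 BY NAME) — difficulty M: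
  `|M^N(s,τ) − M^N(0,τ)| ≤ C s + e_N` along the Euler activity family.  Pointer for provers: the density clause has
  LANDED (`Theorems.RestartPrinciple.AgeDuhamelForgetting.meanMapRegularity_density`) and the momentum / energy
  clauses are REDUCED in tree to the mean collision-flux bound along the family and cubic velocity moments along the
  flow (`mmr_momentum_of_collisionFlux`, `mmr_energy_of_collisionFlux_of_cubicMoment`, `mmr_of_collisionFlux_of_cubicMoment`);
  the sibling line `Cruxes/RestartPrinciple/Lines/IdeatorFourSketch.lean` carries exactly those two inputs as its stubs
  `stub_collisionFluxAlongFamily`, `stub_cubicMomentAlongFamily` — a proof of either registration closes stmt-15330 for both.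

CONSUMED AS THEOREMS (landed, items closed): `meansByCharacteristics_holds : MeansByCharacteristics` (stmt-15334;
the antidiagonal telescope `FlowBoxDecoupling → MeanMapRegularity → EulerProfileFamily → MeanHydroLimitInBand`) and
`stub_eulerProfileFamily : EulerProfileFamily` (stmt-15331; the Euler activity family), both in
`Theorems.RestartPrinciple.AgeDuhamelForgetting`.

ASSEMBLY (kernel-checked, no `sorry`): `EngineReduction_of : RigidityTransfer → SufficiencyToFlowBox →
MeanMapRegularity → EngineReduction`, `fun hR hS hReg c₁ c₂ c₃ ↦ meansByCharacteristics_holds (hS (hR c₁ c₂ c₃) c₁ c₂ c₃)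
hReg stub_eulerProfileFamily`; the hypotheses are route items BY NAME (tagged `route_item`), the conclusion is the crux
decl BY NAME; the closing `example` applies it to the three `stub_…` literally.  Sorries: exactly the three stubs.

Disproof used: none relevant — no `Cruxes/EngineReduction/Disproof.lean`, no `_false_without_` theorem and no
`Theorems/EngineReduction/Negative/` lemma exist at registration (`ledger crux ls`: no workfiles); `ledger negatives
--problem AtomisticToContinuum` (20 entries, 2026-08-17) contains no statement of route ResponseRigidity and none of
the three stub types; the `Theorems/RestartPrinciple/Negative/*` lemmas concern the `S → G` shape of `RestartPrinciple`
only.  BC3 probes (folder `bc/EngineReduction_probe.lean`): for each stub, `stub → EngineReduction` and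
`stub → _root_.HydrodynamicLimit` by `first | exact? | simpa [stub] | (unfold stub; simpa) | aesop` FAIL (6/6) — no stub
is cheaply the crux or the summit: `RigidityTransfer` stops at hydrodynamic SUFFICIENCY of the one-sphere response (no
identification of means), `SufficiencyToFlowBox` needs that sufficiency as input, `MeanMapRegularity` is short-time
regularity of the mean map only.
-/

open Summit.AtomisticToContinuum.HydrodynamicLimit.Theses
open Summit.AtomisticToContinuum.HydrodynamicLimit.Theorems.RestartPrinciple.AgeDuhamelForgetting
  (meansByCharacteristics_holds stub_eulerProfileFamily)

namespace Summit.AtomisticToContinuum.HydrodynamicLimit.Cruxes.EngineReduction.Birth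

/-! ### The three stubs (open; each typed BY NAME on the route's own support item) -/

/-- STUB 1 — THE ENGINE (= support item stmt-AtomisticToContinuum-15332 `ResponseRigidity.RigidityTransfer`, verbatim by
name): renewal + rigidity + absorption turn slaved contact synergy (C1), CLT-scale concentration (C2) and the one-sphere
renewal defect (C3) into HYDRODYNAMIC SUFFICIENCY of the one-sphere response — along every Euler activity family, for
`s ≥ δ`, the `(N+1)`-scaled conditional mean of the far-future tested conserved field given one sphere's state is within
`κ` in `L²(LG_τ)` of `α(q₀) + β(q₀)·v₀ + γ(q₀)|v₀|²`.  Load-bearing inputs: Campbell/Palm calculus of the tagged collision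
process under local Gibbs laws, `ker L = span{1,v,|v|²}` + gap of the linearised hard-sphere operator (Baranger–Mouhot),
Bessel/Efron–Stein.  Difficulty L. -/
theorem stub_rigidityTransfer : ResponseRigidity.RigidityTransfer := by
  sorry

/-- STUB 2 — SUFFICIENCY ⇒ FLOW BOX (= support item stmt-AtomisticToContinuum-15333 `ResponseRigidity.SufficiencyToFlowBox`,
verbatim by name): given hydrodynamic sufficiency of the one-sphere response and C1–C3, the two-parameter mean map
`M^N(s,τ) = E_{LG_τ}[⟨U_N(Φ_s·),χ⟩]` decouples along the flow box, `|M^N(s+h,τ) − M^N(s,τ+h)| ≤ κh` for `s ≥ δ`, small `h`,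
`N ≥ N₀(h)` — exact score identities (exponential family in `τ`, Kawasaki/TTCF in `s` with the collisional score as a
contact-flux integral) + Yau's cancellation of the hydrodynamic projection; the ⊥-remainder is killed by sufficiency
(kinetic part) and by the Hoeffding split + slaving (collisional part).  Difficulty L. -/
theorem stub_sufficiencyToFlowBox : ResponseRigidity.SufficiencyToFlowBox := by
  sorry

/-- STUB 3 — SHORT-TIME REGULARITY OF THE MEAN MAP (= support item stmt-AtomisticToContinuum-15330
`ResponseRigidity.MeanMapRegularity`, verbatim by name): along every Euler activity family `|M^N(s,τ) − M^N(0,τ)| ≤ C s + e_N`,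
`e_N → 0`, for the density / momentum / energy fields (bounded mean kinetic flux by energy; mean collisional transfer
`≤ C s + o(1)`).  Density clause landed (`meanMapRegularity_density`); momentum/energy clauses reduced in tree to the mean
collision-flux bound along the family + cubic velocity moments (`mmr_of_collisionFlux_of_cubicMoment`).  Difficulty M. -/
theorem stub_meanMapRegularity : ResponseRigidity.MeanMapRegularity := by
  sorry

/-! ### The composition (kernel-checked, no `sorry`) -/

/-- **`EngineReduction` from the three stubs** (the crux BY NAME): given the engine `hR`, the flow-box step `hS` and the
mean-map regularity `hReg`, for cruxes `c₁ c₂ c₃` the engine gives hydrodynamic sufficiency `hR c₁ c₂ c₃`, the flow-box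
step gives `FlowBoxDecoupling`, and the LANDED antidiagonal telescope `meansByCharacteristics_holds` (stmt-15334) fed with
`hReg` and the LANDED Euler activity family `stub_eulerProfileFamily` (stmt-15331) gives `MeanHydroLimitInBand`. -/
theorem EngineReduction_of : ResponseRigidity.RigidityTransfer → ResponseRigidity.SufficiencyToFlowBox →
    ResponseRigidity.MeanMapRegularity → ResponseRigidity.EngineReduction :=
  fun hR hS hReg c₁ c₂ c₃ => meansByCharacteristics_holds (hS (hR c₁ c₂ c₃) c₁ c₂ c₃) hReg stub_eulerProfileFamily

/-- The composition applied to the three registered stubs literally (checks that stubs and hypotheses agree). -/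
example : ResponseRigidity.EngineReduction :=
  EngineReduction_of stub_rigidityTransfer stub_sufficiencyToFlowBox stub_meanMapRegularity

end Summit.AtomisticToContinuum.HydrodynamicLimit.Cruxes.EngineReduction.Birth
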